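import Literature.Probability.LatticeModels.DiscreteRectBoundaryTrace
import Mathlib.Analysis.Convex.PathConnected
import HarnessLib

/-!
# The offset boundary polygon of a boundary-tracing orbit (definitions)
(line `fk-anchor-transfer`, crux `IsingBoundaryRatio`, stmt-CriticalPhenomena-10650; definitions module for the
stub `windowRectPresentation_holds : WindowRectPresentation` of `…IsingBoundaryRatioWindowRectDefs.lean`)

For a discrete domain presented by its edge set `E ⊆ 𝓔(ℤ²)` drawn at mesh `δ`, and an offset `0 < η ≤ δ/4`,
every vertex `x` is thickened to the closed square of half-side `η` about `δx`, every edge to the band of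
half-width `η` about its segment. The boundary-tracing orbit `d₀, succ d₀, succ² d₀, …` of external darts
(`DiscreteRect.succ`, CDH16 §2.1) is then drawn as a rectilinear closed polygon running along the boundary
of this thickening: the external dart `(x, k)` (missing edge from `x` in direction `e_k`) is drawn as the
side of the square about `δx` facing `e_k`, traversed in direction `e_{k+1}` (square on the left) through
its midpoint, the **bud** `δx + η e_k`; consecutive sides are joined along the outer sides of the bands of
the (at most three) edges of `E` round which `succ` turns. This module only NAMES these objects:

* `framePt δ a t s = δ·a.1 + t e_k + s e_{k+1}` (`a = (a.1, k)`) — the point with coordinates `(t, s)` in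
  the frame of the arrow `a`; buds are `framePt δ d η 0`, the ends of the side of `d` are `framePt δ d η (∓η)`;
* `linkPath E δ η d` — the connector from the end of the side of `d` to the start of the side of `succ E d`
  (by the four branches of `succ`: nothing, one, two or three straight pieces);
* `stepPath E δ η d` — from the bud of `d` to the bud of `succ E d`; `arcPath E δ η d m` — `m` consecutive
  steps, from the bud of `d` to the bud of `succ^[m] d`.

The polygon is used (in the proof files) only through winding numbers: it separates points just inside a
bud from points just outside, which is how the single boundary cycle of a simply connected domain and the
cyclic order of its boundary darts are controlled. Nothing is asserted here. [folklore]
-/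

noncomputable section

open scoped Classical
open Literature.Probability.LatticeModels Literature.Probability.LatticeModels.DiscreteRect

namespace Summit.CriticalPhenomena.SAWScalingLimit.Theorems.IsingBoundaryRatio

namespace WindowRect

/-- **Frame point** of the arrow `a = (v, k)` at mesh `δ`: `δ v + t e_k + s e_{k+1}`, the point with
coordinates `(t, s)` in the orthonormal frame `(e_k, e_{k+1})` at the lattice point `δ v`
(`meshPoint t (dir k) = t e_k`). [folklore] -/
def framePt (δ : ℝ) (a : Site 2 × Fin 4) (t s : ℝ) : ℂ :=
  meshPoint δ a.1 + meshPoint t (dir a.2) + meshPoint s (dir (a.2 + 1))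

/-- **Connector** of the offset boundary polygon after the external dart `d = (x, k)`: from the end
`framePt δ d η η` of the side of `d` to the start `framePt δ (succ E d) η (-η)` of the side of the next
dart, following the branch of `DiscreteRect.succ` taken at `d` — the same point (missing edge
`x, x + e_{k+1}`), or straight along the band of the edge `x, x + e_{k+1}`, then possibly along the band
of `y, y + e_k` (`y = x + e_{k+1}`), then possibly along the band of `y + e_k, x + e_k`, turning at the
corners `framePt δ (y, k) η (-η)` and `framePt δ (y + e_k, k) (-η) (-η)` of the squares about `δy`,
`δ(y + e_k)`. [folklore] -/
def linkPath (E : Finset (Sym2 (Site 2))) (δ η : ℝ) (d : Site 2 × Fin 4) :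
    Path (framePt δ d η η) (framePt δ (succ E d) η (-η)) :=
  if s(d.1, d.1 + dir (d.2 + 1)) ∉ E then Path.segment _ _
  else if s(d.1 + dir (d.2 + 1), d.1 + dir (d.2 + 1) + dir d.2) ∉ E then Path.segment _ _
  else if s(d.1 + dir (d.2 + 1) + dir d.2, d.1 + dir d.2) ∉ E then
    (Path.segment _ (framePt δ (d.1 + dir (d.2 + 1), d.2) η (-η))).trans (Path.segment _ _)
  else
    (Path.segment _ (framePt δ (d.1 + dir (d.2 + 1), d.2) η (-η))).trans
      ((Path.segment _ (framePt δ (d.1 + dir (d.2 + 1) + dir d.2, d.2) (-η) (-η))).trans (Path.segment _ _))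

/-- **One step** of the offset boundary polygon: from the bud `framePt δ d η 0` of the external dart `d`
along the second half of its side, the connector, and the first half of the side of `succ E d`, to the
bud of `succ E d`. [folklore] -/
def stepPath (E : Finset (Sym2 (Site 2))) (δ η : ℝ) (d : Site 2 × Fin 4) :
    Path (framePt δ d η 0) (framePt δ (succ E d) η 0) :=
  (Path.segment _ (framePt δ d η η)).trans ((linkPath E δ η d).trans (Path.segment _ _))

/-- **The offset boundary polygon** from the bud of `d` through `m` steps of the boundary-tracing orbit,
to the bud of `succ^[m] d`; for an orbit of period `N`, `arcPath E δ η d₀ N` is the closed polygon.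
[folklore] -/
def arcPath (E : Finset (Sym2 (Site 2))) (δ η : ℝ) :
    (d : Site 2 × Fin 4) → (m : ℕ) → Path (framePt δ d η 0) (framePt δ ((succ E)^[m] d) η 0)
  | _, 0 => Path.refl _
  | d, m + 1 => (stepPath E δ η d).trans (arcPath E δ η (succ E d) m)

/-- `arcPath … d 0` is the constant path. [folklore] -/
@[simp] theorem arcPath_zero (E : Finset (Sym2 (Site 2))) (δ η : ℝ) (d : Site 2 × Fin 4) :
    arcPath E δ η d 0 = Path.refl _ := rfl

/-- `arcPath … d (m+1)` is one step followed by `m` steps from `succ E d`. [folklore] -/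
theorem arcPath_succ (E : Finset (Sym2 (Site 2))) (δ η : ℝ) (d : Site 2 × Fin 4) (m : ℕ) :
    arcPath E δ η d (m + 1) = (stepPath E δ η d).trans (arcPath E δ η (succ E d) m) := rfl

/-- Coordinates of a frame point: real part. [folklore] -/
@[simp] theorem framePt_re (δ : ℝ) (a : Site 2 × Fin 4) (t s : ℝ) :
    (framePt δ a t s).re = δ * a.1 0 + t * dir a.2 0 + s * dir (a.2 + 1) 0 := by
  simp [framePt]

/-- Coordinates of a frame point: imaginary part. [folklore] -/
@[simp] theorem framePt_im (δ : ℝ) (a : Site 2 × Fin 4) (t s : ℝ) :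
    (framePt δ a t s).im = δ * a.1 1 + t * dir a.2 1 + s * dir (a.2 + 1) 1 := by
  simp [framePt]

end WindowRect

/-- The polygon with no step is the bud of its dart (registered sub-goal of stmt-CriticalPhenomena-10650,
anchoring this definitions module). [folklore] -/
theorem windowRect_range_arcPath_zero : ∀ (E : Finset (Sym2 (Site 2))) (δ η : ℝ) (d : Site 2 × Fin 4), Set.range (WindowRect.arcPath E δ η d 0) = {WindowRect.framePt δ d η 0} := by
  intro E δ η d
  exact Path.refl_range

end Summit.CriticalPhenomena.SAWScalingLimit.Theorems.IsingBoundaryRatio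

end
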